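import Summits.CriticalPhenomena.PercolationContinuityZ3.Theorems.SahiMasterFamilyResidualStep
import Summits.CriticalPhenomena.PercolationContinuityZ3.Theorems.PercNearOneGluingNoHeavyLowerTailSahiMeetTowerAllOrders

/-!
# A fifth reducible stratum of the `k → k+1` step: a member ABSORBING THE PAIRWISE MEETS of the others (every `k`)

Companion of `SahiMasterFamilyResidualStep.lean` (crux `NoHeavyLowerTail`, stmt-CriticalPhenomena-4575; unit `prim-masterthm-p4`) and of
seat `prim-l12-p5`'s hierarchy identity `SahiMeetTowerAll.sahiE_cons_eq_of_pairwise`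
(`PercNearOneGluingNoHeavyLowerTailSahiMeetTowerAllOrders.lean`): if `d` absorbs every pairwise product of `f_0,…,f_{n+1}` then
  `E_{n+3}(d, f) = (n + 2 − E d)·E_{n+2}(f) + Σ_i E[f_i(1 − d)]·E_{n+1}(f ∖ f_i)`      (any weight).
For increasing events under a product measure this makes "some member `U_m` contains `U_i ∩ U_j` for all other `i ≠ j`" (a MEET-ABSORBING
member; weaker than a comparable pair, which needs `U_m ⊇ U_i`) a reducible stratum for BOTH halves of the master statement:
* `sahiE_ind_nonneg_of_meetAbsorbing` — GIVEN `MasterFamilyNonneg (k+2)`: `E_{k+3}(μ_p; 1_U) ≥ 0` (p5's rung, event form, any slot);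
* `sahiE_ind_eq_zero_iff_of_meetAbsorbing` — GIVEN `MasterFamilyEqIff (k+2)`: for `p` interior `E_{k+3}(μ_p; 1_U) = 0 ↔ U ∈ Z_{k+3}`:
  a zero forces `E_{k+2}(U_{−m}) = 0` (the coefficient `k + 2 − P(U_m) ≥ k + 1 > 0` and all terms are `≥ 0`) — heredity at the absorbing
  slot — and the peeled step `masterFamily_step` concludes;
* unconditional at order 3 (`sahiE_three_ind_eq_zero_iff_of_meetAbsorbing`: `U_i ∩ U_j ⊆ U_m` ⇒ `E_3 ≥ 0 ∧ (E_3 = 0 ↔ Z_3)`), order 4 given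
  `MasterFamilyEqIff 3`.
So the one-step residual class of MASTER-ROUTES §P4 shrinks to: antichains with no cylinder member, no member independent of the rest, no
deleted family in `Z_{k+2}`, AND no member containing all pairwise meets of the others.  HONEST FRAMING: nothing here asserts `C_k` or
(EQ-k) for `k ≥ 3`. [this work] -/

set_option autoImplicit false

open Finset
open scoped Classical

namespace Summit.CriticalPhenomena.PercolationContinuityZ3.Theorems

open Literature.Combinatorics.Sahi2008
open MeasureTheory Function
open Literature.Probability.Percolation (DeterminedBy)
open Literature.Probability.Percolation.DecisionTree (ind ind_of_mem ind_of_not_mem ind_nonneg)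

variable {ι : Type} [Fintype ι]

omit [Fintype ι] in
/-- Absorption of a pairwise meet by indicators: `U ∩ V ⊆ D ⇒ 1_U·1_V·1_D = 1_U·1_V`. [folklore] -/
theorem ind_mul_ind_mul_ind_eq_of_inter_subset {U V D : Set (Set ι)} (h : U ∩ V ⊆ D) :
    ind U * ind V * ind D = ind U * ind V := by
  rw [ind_mul_ind_eq_inter, ind_mul_ind_eq_inter, Set.inter_eq_left.2 h]

omit [Fintype ι] in
/-- `1_D ≤ 1`. [folklore] -/
theorem ind_le_one' (D : Set (Set ι)) (ω : Set ι) : ind D ω ≤ 1 := by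
  by_cases h : ω ∈ D
  · rw [ind_of_mem h]
  · rw [ind_of_not_mem h]; exact zero_le_one

/-- **Positivity on the meet-absorbing stratum (every `k`).**  GIVEN `MasterFamilyNonneg (k+2)`, a family of `k + 3` increasing events with
a member `U_m ⊇ U_i ∩ U_j` for all other `i ≠ j` has `E_{k+3}(μ_p; 1_U) ≥ 0`, every `p ∈ [0,1]^ι`. [this work] -/
theorem sahiE_ind_nonneg_of_meetAbsorbing {k : ℕ} (hN : MasterFamilyNonneg (k + 2)) (p : ι → unitInterval)
    (U : Fin (k + 3) → Set (Set ι)) (hU : ∀ j, IsUpperSet (U j)) (m : Fin (k + 3))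
    (hmeet : ∀ i j : Fin (k + 2), i ≠ j → U (m.succAbove i) ∩ U (m.succAbove j) ⊆ U m) :
    0 ≤ sahiE (bernoulliWeight p) (k + 3) (fun j => ind (U j)) := by
  obtain ⟨τ, hτ⟩ := exists_perm_sahiE_ind_eq_cons (bernoulliWeight p) U m
  rw [hτ]
  have hN' : MasterFamilyNonneg (k + 1) := masterFamilyNonneg_antitone (Nat.le_succ _) hN
  refine SahiMeetTowerAll.sahiE_cons_nonneg_of_pairwise (bernoulliWeight p) (isFKGMeasure_bernoulliWeight p).nonneg
    (sum_bernoulliWeight p) k (ind (U m)) (fun j => ind (U (m.succAbove (τ j)))) (fun i ω => ind_nonneg _ _)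
    (ind_le_one' (U m)) (fun i j hij => ind_mul_ind_mul_ind_eq_of_inter_subset
      (hmeet (τ i) (τ j) fun h => hij (τ.injective h))) (hN ι p _ fun j => hU _) fun i => ?_
  exact hN' ι p (fun j => U (m.succAbove (τ (i.succAbove j)))) fun j => hU _

/-- **The zero locus on the meet-absorbing stratum (every `k`).**  GIVEN `MasterFamilyEqIff (k+2)`, for `p` in the open cube a family of
`k + 3` increasing events with a member `U_m ⊇ U_i ∩ U_j` for all other `i ≠ j` has `E_{k+3}(μ_p; 1_U) = 0 ↔ U ∈ Z_{k+3}` (a zero forces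
`E_{k+2}(U_{−m}) = 0`: heredity at the absorbing slot). [this work] -/
theorem sahiE_ind_eq_zero_iff_of_meetAbsorbing {k : ℕ} (hE : MasterFamilyEqIff (k + 2)) (p : ι → unitInterval)
    (hp : ∀ e, (p e : ℝ) ∈ Set.Ioo (0 : ℝ) 1) (U : Fin (k + 3) → Set (Set ι)) (hU : ∀ j, IsUpperSet (U j)) (m : Fin (k + 3))
    (hmeet : ∀ i j : Fin (k + 2), i ≠ j → U (m.succAbove i) ∩ U (m.succAbove j) ⊆ U m) :
    sahiE (bernoulliWeight p) (k + 3) (fun j => ind (U j)) = 0 ↔ SuppZeroFlag (k + 3) U := by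
  have hN : MasterFamilyNonneg (k + 2) := masterFamilyNonneg_of_masterFamilyEqIff hE
  have hN' : MasterFamilyNonneg (k + 1) := masterFamilyNonneg_antitone (Nat.le_succ _) hN
  refine ⟨fun h0 => ?_, fun hZ => masterFamilyEqIff_mpr (k + 3) ι p U hZ⟩
  obtain ⟨τ, hτ⟩ := exists_perm_sahiE_ind_eq_cons (bernoulliWeight p) U m
  set f : Fin (k + 2) → Set ι → ℝ := fun j => ind (U (m.succAbove (τ j))) with hf_def
  have hpair : ∀ i j, i ≠ j → f i * f j * ind (U m) = f i * f j := fun i j hij =>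
    ind_mul_ind_mul_ind_eq_of_inter_subset (hmeet (τ i) (τ j) fun h => hij (τ.injective h))
  have hid := SahiMeetTowerAll.sahiE_cons_eq_of_pairwise (bernoulliWeight p) k (ind (U m)) f hpair
  have h1 : sahiE (bernoulliWeight p) (k + 3) (Fin.cons (ind (U m)) f : Fin (k + 3) → Set ι → ℝ) = 0 := by
    rw [← h0, hτ]; rfl
  rw [h1] at hid
  -- both parts of the identity are nonnegative, so the first vanishes
  have hEf : 0 ≤ sahiE (bernoulliWeight p) (k + 2) f := hN ι p _ fun j => hU _
  have hcoef : 0 < (k : ℝ) + 2 - ex (bernoulliWeight p) (ind (U m)) := by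
    have := ex_bernoulliWeight_ind_le_one p (U m)
    have hk : (0 : ℝ) ≤ k := Nat.cast_nonneg k
    linarith
  have hsum : 0 ≤ ∑ i, ex (bernoulliWeight p) (f i - f i * ind (U m)) * sahiE (bernoulliWeight p) (k + 1) (i.removeNth f) :=
    Finset.sum_nonneg fun i _ => mul_nonneg
      (ex_nonneg (isFKGMeasure_bernoulliWeight p).nonneg fun ω => by
        simp only [Pi.sub_apply, Pi.mul_apply]
        nlinarith [ind_nonneg (U (m.succAbove (τ i))) ω, ind_le_one' (U m) ω])
      (hN' ι p (fun j => U (m.succAbove (τ (i.succAbove j)))) fun j => hU _)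
  have hEf0 : sahiE (bernoulliWeight p) (k + 2) f = 0 := by
    have hprod : ((k : ℝ) + 2 - ex (bernoulliWeight p) (ind (U m))) * sahiE (bernoulliWeight p) (k + 2) f = 0 := by
      have := mul_nonneg hcoef.le hEf
      linarith
    rcases mul_eq_zero.1 hprod with h | h
    · exact absurd h hcoef.ne'
    · exact h
  -- the deleted family `U_{−m}` is `f` up to the permutation `τ`
  have hdel : sahiE (bernoulliWeight p) (k + 2) (fun j => ind (U (m.succAbove j))) = 0 := by
    rw [← sahiE_ind_comp_perm (bernoulliWeight p) τ (fun j => U (m.succAbove j))]; exact hEf0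
  have hZ : SuppZeroFlag (k + 2) (fun j => U (m.succAbove j)) := (hE ι p hp _ fun j => hU _).1 hdel
  exact (masterFamily_step hN hE p hp U hU m hZ).2.1 h0

/-- **Unconditionally at order 3** ("meet containment" `U_i ∩ U_j ⊆ U_m`): `E_3 ≥ 0` and `E_3 = 0 ↔ Z_3` (interior `p`). [this work] -/
theorem sahiE_three_ind_eq_zero_iff_of_meetAbsorbing (p : ι → unitInterval) (hp : ∀ e, (p e : ℝ) ∈ Set.Ioo (0 : ℝ) 1)
    (U : Fin 3 → Set (Set ι)) (hU : ∀ j, IsUpperSet (U j)) (m : Fin 3)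
    (hmeet : ∀ i j : Fin 2, i ≠ j → U (m.succAbove i) ∩ U (m.succAbove j) ⊆ U m) :
    0 ≤ sahiE (bernoulliWeight p) 3 (fun j => ind (U j)) ∧
      (sahiE (bernoulliWeight p) 3 (fun j => ind (U j)) = 0 ↔ SuppZeroFlag 3 U) :=
  ⟨sahiE_ind_nonneg_of_meetAbsorbing (masterFamilyNonneg_of_le_two le_rfl) p U hU m hmeet,
    sahiE_ind_eq_zero_iff_of_meetAbsorbing masterFamilyEqIff_two p hp U hU m hmeet⟩

/-- **At order 4, given `MasterFamilyEqIff 3`**: a quadruple of increasing events with a member containing the three pairwise meets of the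
others has `E_4 ≥ 0` and `E_4 = 0 ↔ Z_4`. [this work] -/
theorem sahiE_four_ind_eq_zero_iff_of_meetAbsorbing (hE : MasterFamilyEqIff 3) (p : ι → unitInterval)
    (hp : ∀ e, (p e : ℝ) ∈ Set.Ioo (0 : ℝ) 1) (U : Fin 4 → Set (Set ι)) (hU : ∀ j, IsUpperSet (U j)) (m : Fin 4)
    (hmeet : ∀ i j : Fin 3, i ≠ j → U (m.succAbove i) ∩ U (m.succAbove j) ⊆ U m) :
    0 ≤ sahiE (bernoulliWeight p) 4 (fun j => ind (U j)) ∧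
      (sahiE (bernoulliWeight p) 4 (fun j => ind (U j)) = 0 ↔ SuppZeroFlag 4 U) :=
  ⟨sahiE_ind_nonneg_of_meetAbsorbing (masterFamilyNonneg_of_masterFamilyEqIff hE) p U hU m hmeet,
    sahiE_ind_eq_zero_iff_of_meetAbsorbing hE p hp U hU m hmeet⟩

end Summit.CriticalPhenomena.PercolationContinuityZ3.Theorems
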